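import Mathlib
import Literature.MathematicalPhysics.QuantumLattice.WilsonDiracAP

/-!
# The antiperiodic `d = 4` Bloch lattice sum with exponent `3/2`
(helper for crux stmt-QuantumFields-9734, line `Sketch`, stub `stub_blochLatticeSum`)

What.  For `h = (m + Σ_μ (1 − cos φ_μ))² + Σ_μ sin² φ_μ` at the antiperiodic angles
`φ_μ = π s_μ + π k_μ/M + π/(2M)` (`k ∈ (Fin M)⁴`, `s ∈ (ℤ/2)⁴`; these are the `(2M)⁴` angles
`(2j+1)π/(2M)`) and `|m| ≤ 1/2`: `Σ_{k,s} √h/h² ≤ 32⁴ · M⁴` for every `M ≥ 1` (`√h/h² = h^{-3/2}`).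
We take `C = 32⁴`, `ε = 1/2`.

How (elementary and separable; no lattice-point counting, no `rpow` — fourth roots are `√√·`, `(√√x)⁴ = x` inlined).
* Pointwise (the bound `h ≥ W` is adapted from the sibling `…WilsonQuarkStabilityStubAPLatticeSum`):
  for `m ≥ −1/2`, `h ≥ W := Σ_μ (1 − cos φ_μ) = 2 Σ_μ sin²(φ_μ/2) ≥ sin²(φ_μ/2)` for EACH `μ`, so with
  `σ = √h ≥ s_μ := sin(φ_μ/2) > 0`: `√h/h² = σ⁻³ ≤ s_μ⁻³` for every `μ`; a minimum is at most the
  geometric mean: `√h/h² ≤ Π_μ s_μ^{-3/4} = Π_μ g_μ`, `g_μ = ((√√ s_μ)⁻¹)³`.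
* Separation: `Σ_k Σ_s Π_μ g(k_μ, s_μ) = (Σ_{k'} Σ_{s'} g(k', s'))⁴` (`Fintype.prod_sum`,
  `Fintype.sum_pow`).
* One dimension: `φ/2 = (2k'+1)π/(4M)` (`s' = 0`) or `π/2 + (2k'+1)π/(4M)` (`s' = 1`), so
  `sin(φ/2) = sin((2i+1)π/(4M))` with `i = k'` resp. `i = M − 1 − k'`; Jordan (`Real.mul_le_sin`)
  gives `sin((2i+1)π/(4M)) ≥ (2i+1)/(2M)`, hence
  `g ≤ (2M)^{3/4} ((2k'+1)^{-3/4} + (2(M−1−k')+1)^{-3/4})`, and the telescoping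
  `(2i+1)^{-3/4} ≤ 4((2i+1)^{1/4} − (2i)^{1/4})` (from `b⁴ − a⁴ = 1`, `(b+a)(b²+a²) ≤ 4b³`) gives
  `Σ_{i<M} (2i+1)^{-3/4} ≤ 4 (2M)^{1/4}`, so `Σ_{k', s'} g ≤ 2 · (2M)^{3/4} · 2 · 4 (2M)^{1/4} = 32 M`.
* Assembly: `Σ ≤ (32 M)⁴ = 32⁴ · M⁴`.

Sources: folklore infrared bound for free Wilson fermions (cf. Montvay–Münster, *Quantum Fields on a
Lattice* §4.2); pattern: sibling `…WilsonQuarkStabilityStubAPLatticeSum` (exponent `1`).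
Pure theorem file (no `def`s), Mathlib only.
-/

noncomputable section

open scoped BigOperators Classical Matrix ComplexConjugate
open Finset
open Literature.MathematicalPhysics.QuantumLattice Literature.MathematicalPhysics.QuantumFieldTheory
  Literature.Probability.LatticeModels

namespace Summit.QuantumFields.QCD.Cruxes.CriticalLineDiamagnetism.ChessboardCellGain

namespace BlochLatticeSum

/-! ### Pointwise bound -/

/-- The algebraic core (adapted from the sibling's `apLatticeSum_alg`): for `m ≥ −1/2` and
`a, b, c, d ≥ 0`, `a + b + c + d ≤ (m + a + b + c + d)² + Σ (2x − x²)`. -/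
theorem alg (m a b c d : ℝ) (hm : -(1 / 2) ≤ m) (ha : 0 ≤ a) (hb : 0 ≤ b)
    (hc : 0 ≤ c) (hd : 0 ≤ d) :
    a + b + c + d ≤ (m + (a + b + c + d)) ^ 2 +
      ((2 * a - a ^ 2) + (2 * b - b ^ 2) + (2 * c - c ^ 2) + (2 * d - d ^ 2)) := by
  nlinarith [mul_nonneg ha hb, mul_nonneg ha hc, mul_nonneg ha hd, mul_nonneg hb hc,
    mul_nonneg hb hd, mul_nonneg hc hd, sq_nonneg m,
    mul_nonneg (by linarith : (0 : ℝ) ≤ 2 * m + 1) (by linarith : 0 ≤ a + b + c + d)]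

/-- `h ≥ W` (adapted from the sibling's `apLatticeSum_h_ge`):
`Σ_μ (1 − cos θ_μ) ≤ (m + Σ_μ (1 − cos θ_μ))² + Σ_μ sin² θ_μ` for `m ≥ −1/2`. -/
theorem h_ge (m : ℝ) (hm : -(1 / 2) ≤ m) (θ : Fin 4 → ℝ) :
    ∑ μ, (1 - Real.cos (θ μ)) ≤
      (m + ∑ μ, (1 - Real.cos (θ μ))) ^ 2 + ∑ μ, Real.sin (θ μ) ^ 2 := by
  have hs : ∀ x : ℝ, Real.sin x ^ 2 = 2 * (1 - Real.cos x) - (1 - Real.cos x) ^ 2 := fun x => by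
    rw [Real.sin_sq]; ring
  simp only [Fin.sum_univ_four, hs]
  exact alg m _ _ _ _ hm (sub_nonneg.2 (Real.cos_le_one _))
    (sub_nonneg.2 (Real.cos_le_one _)) (sub_nonneg.2 (Real.cos_le_one _))
    (sub_nonneg.2 (Real.cos_le_one _))

/-- Each squared half-angle sine is below `h`: `sin²(θ_μ/2) ≤ h(θ)` for `m ≥ −1/2`
(`sin²(θ_μ/2) ≤ 2 sin²(θ_μ/2) = 1 − cos θ_μ ≤ W ≤ h`). -/
theorem sin_half_sq_le (m : ℝ) (hm : -(1 / 2) ≤ m) (θ : Fin 4 → ℝ) (μ : Fin 4) :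
    Real.sin (θ μ / 2) ^ 2 ≤
      (m + ∑ ν, (1 - Real.cos (θ ν))) ^ 2 + ∑ ν, Real.sin (θ ν) ^ 2 := by
  have h1 : Real.sin (θ μ / 2) ^ 2 ≤ 1 - Real.cos (θ μ) := by
    rw [Real.sin_sq_eq_half_sub, show 2 * (θ μ / 2) = θ μ by ring]
    linarith [Real.cos_le_one (θ μ)]
  have h2 : 1 - Real.cos (θ μ) ≤ ∑ ν, (1 - Real.cos (θ ν)) :=
    Finset.single_le_sum (f := fun ν => 1 - Real.cos (θ ν))
      (fun ν _ => sub_nonneg.2 (Real.cos_le_one _)) (Finset.mem_univ μ)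
  exact h1.trans (h2.trans (h_ge m hm θ))

/-- **Pointwise bound.**  If all `sin(θ_μ/2) > 0` and `m ≥ −1/2` then
`√h/h² ≤ Π_μ ((√√ sin(θ_μ/2))⁻¹)³`: `√h/h² = (√h)⁻³ ≤ sin(θ_μ/2)⁻³` for every `μ`, and a minimum
over `μ` is bounded by the geometric mean. -/
theorem pointwise (m : ℝ) (hm : -(1 / 2) ≤ m) (θ : Fin 4 → ℝ)
    (hθ : ∀ μ, 0 < Real.sin (θ μ / 2)) :
    Real.sqrt ((m + ∑ μ, (1 - Real.cos (θ μ))) ^ 2 + ∑ μ, Real.sin (θ μ) ^ 2) /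
        ((m + ∑ μ, (1 - Real.cos (θ μ))) ^ 2 + ∑ μ, Real.sin (θ μ) ^ 2) ^ 2 ≤
      ∏ μ, (Real.sqrt (Real.sqrt (Real.sin (θ μ / 2))))⁻¹ ^ 3 := by
  set H := (m + ∑ μ, (1 - Real.cos (θ μ))) ^ 2 + ∑ μ, Real.sin (θ μ) ^ 2 with hH
  have hsH : ∀ μ, Real.sin (θ μ / 2) ^ 2 ≤ H := fun μ => sin_half_sq_le m hm θ μ
  have hHpos : 0 < H := lt_of_lt_of_le (pow_pos (hθ 0) 2) (hsH 0)
  set σ := Real.sqrt H with hσ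
  have hσpos : 0 < σ := Real.sqrt_pos.2 hHpos
  have hHσ : H = σ ^ 2 := (Real.sq_sqrt hHpos.le).symm
  have hF : σ / H ^ 2 = (σ ^ 3)⁻¹ := by
    rw [hHσ]
    field_simp
  have hsσ : ∀ μ, Real.sin (θ μ / 2) ≤ σ := fun μ =>
    (Real.le_sqrt (hθ μ).le hHpos.le).2 (hsH μ)
  set g : Fin 4 → ℝ := fun μ => (Real.sqrt (Real.sqrt (Real.sin (θ μ / 2))))⁻¹ ^ 3 with hg
  have hg0 : ∀ μ, 0 ≤ g μ := fun μ => by positivity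
  have hg4 : ∀ μ, g μ ^ 4 = (Real.sin (θ μ / 2) ^ 3)⁻¹ := fun μ => by
    simp only [hg, inv_pow, ← pow_mul]
    rw [show 3 * 4 = 2 * 2 * 3 from rfl, pow_mul, pow_mul, Real.sq_sqrt (Real.sqrt_nonneg _),
      Real.sq_sqrt (hθ μ).le]
  have hFle : ∀ μ, (σ ^ 3)⁻¹ ≤ g μ ^ 4 := fun μ => by
    rw [hg4]
    exact inv_anti₀ (pow_pos (hθ μ) 3) (pow_le_pow_left₀ (hθ μ).le (hsσ μ) 3)
  rw [hF]
  have h4 : ((σ ^ 3)⁻¹) ^ 4 ≤ (∏ μ, g μ) ^ 4 :=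
    calc ((σ ^ 3)⁻¹) ^ 4 = ∏ _μ : Fin 4, (σ ^ 3)⁻¹ := (Fin.prod_const 4 _).symm
      _ ≤ ∏ μ, g μ ^ 4 := Finset.prod_le_prod (fun _ _ => by positivity) fun μ _ => hFle μ
      _ = (∏ μ, g μ) ^ 4 := Finset.prod_pow _ _ _
  exact (pow_le_pow_iff_left₀ (by positivity) (Finset.prod_nonneg fun μ _ => hg0 μ)
    four_ne_zero).1 h4

/-! ### Jordan's inequality on the antiperiodic grid -/

/-- Jordan on the grid: for `1 ≤ n ≤ L`, `sin(nπ/(2L)) ≥ n/L > 0`, hence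
`((√√ sin(nπ/(2L)))⁻¹)³ ≤ (√√L)³ · ((√√n)³)⁻¹`. -/
theorem jordan (n L : ℕ) (hn : 1 ≤ n) (hnL : n ≤ L) :
    0 < Real.sin ((n : ℝ) * Real.pi / (2 * L)) ∧
    (Real.sqrt (Real.sqrt (Real.sin ((n : ℝ) * Real.pi / (2 * L)))))⁻¹ ^ 3 ≤
      Real.sqrt (Real.sqrt L) ^ 3 * (Real.sqrt (Real.sqrt n) ^ 3)⁻¹ := by
  have hL : (0 : ℝ) < L := by exact_mod_cast (show 0 < L by omega)
  have hn' : (0 : ℝ) < n := by exact_mod_cast (show 0 < n by omega)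
  have hq : 0 < (n : ℝ) / L := div_pos hn' hL
  have hq1 : (n : ℝ) / L ≤ 1 := by rw [div_le_one hL]; exact_mod_cast hnL
  have hx : (n : ℝ) * Real.pi / (2 * L) = (n : ℝ) / L * (Real.pi / 2) := by ring
  have hx0 : 0 ≤ (n : ℝ) / L * (Real.pi / 2) := by positivity
  have hx1 : (n : ℝ) / L * (Real.pi / 2) ≤ Real.pi / 2 := by
    calc (n : ℝ) / L * (Real.pi / 2) ≤ 1 * (Real.pi / 2) :=
          mul_le_mul_of_nonneg_right hq1 (by positivity)
      _ = Real.pi / 2 := one_mul _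
  have hkey : 2 / Real.pi * (Real.pi / 2) = 1 := by
    rw [div_mul_div_comm, mul_comm Real.pi 2, div_self (by positivity : (2 : ℝ) * Real.pi ≠ 0)]
  have hsin : (n : ℝ) / L ≤ Real.sin ((n : ℝ) * Real.pi / (2 * L)) := by
    have h := Real.mul_le_sin hx0 hx1
    rw [mul_left_comm, hkey, mul_one, ← hx] at h
    exact h
  refine ⟨hq.trans_le hsin, ?_⟩
  have h1 : (Real.sqrt (Real.sqrt (Real.sin ((n : ℝ) * Real.pi / (2 * L)))))⁻¹ ≤
      Real.sqrt (Real.sqrt L) / Real.sqrt (Real.sqrt n) :=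
    calc _ ≤ (Real.sqrt (Real.sqrt ((n : ℝ) / L)))⁻¹ :=
          inv_anti₀ (Real.sqrt_pos.2 (Real.sqrt_pos.2 hq))
            (Real.sqrt_le_sqrt (Real.sqrt_le_sqrt hsin))
      _ = Real.sqrt (Real.sqrt L) / Real.sqrt (Real.sqrt n) := by
          rw [Real.sqrt_div' _ hL.le, Real.sqrt_div' _ (Real.sqrt_nonneg _), inv_div]
  calc _ ≤ (Real.sqrt (Real.sqrt L) / Real.sqrt (Real.sqrt n)) ^ 3 :=
        pow_le_pow_left₀ (inv_nonneg.2 (Real.sqrt_nonneg _)) h1 3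
    _ = _ := by rw [div_pow, div_eq_mul_inv]

/-- **Per-site bound** at the antiperiodic angle `θ = π v + (π k/M + π/(2M))`, `k < M`, `v < 2`:
`sin(θ/2) > 0` and `((√√ sin(θ/2))⁻¹)³ ≤ (√√(2M))³ (((√√(2k+1))³)⁻¹ + ((√√(2(M−1−k)+1))³)⁻¹)`
(`v = 0`: `θ/2 = (2k+1)π/(4M)`; `v = 1`: `sin(θ/2) = sin(π − θ/2)`, `π − θ/2 = (2(M−1−k)+1)π/(4M)`). -/
theorem coord (M k v : ℕ) (hk : k < M) (hv : v < 2) :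
    0 < Real.sin ((Real.pi * (v : ℝ) + (Real.pi * (k : ℝ) / M + Real.pi / (2 * M))) / 2) ∧
    (Real.sqrt (Real.sqrt (Real.sin
        ((Real.pi * (v : ℝ) + (Real.pi * (k : ℝ) / M + Real.pi / (2 * M))) / 2))))⁻¹ ^ 3 ≤
      Real.sqrt (Real.sqrt ((2 * M : ℕ) : ℝ)) ^ 3 *
        ((Real.sqrt (Real.sqrt ((2 * k + 1 : ℕ) : ℝ)) ^ 3)⁻¹ +
          (Real.sqrt (Real.sqrt ((2 * (M - 1 - k) + 1 : ℕ) : ℝ)) ^ 3)⁻¹) := by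
  have hM : (0 : ℝ) < M := by exact_mod_cast (show 0 < M by omega)
  obtain ⟨w, hw⟩ : ∃ w, k + w + 1 = M := ⟨M - k - 1, by omega⟩
  have hw' : M - 1 - k = w := by omega
  have hwr : (w : ℝ) = M - k - 1 := by
    have h : ((k + w + 1 : ℕ) : ℝ) = M := by exact_mod_cast hw
    push_cast at h
    linarith
  rw [hw']
  have ha : 0 ≤ (Real.sqrt (Real.sqrt ((2 * k + 1 : ℕ) : ℝ)) ^ 3)⁻¹ := by positivity
  have hb : 0 ≤ (Real.sqrt (Real.sqrt ((2 * w + 1 : ℕ) : ℝ)) ^ 3)⁻¹ := by positivity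
  have hc : 0 ≤ Real.sqrt (Real.sqrt ((2 * M : ℕ) : ℝ)) ^ 3 := by positivity
  obtain rfl | rfl : v = 0 ∨ v = 1 := by omega
  · have hx : (Real.pi * ((0 : ℕ) : ℝ) + (Real.pi * (k : ℝ) / M + Real.pi / (2 * M))) / 2 =
        ((2 * k + 1 : ℕ) : ℝ) * Real.pi / (2 * ((2 * M : ℕ) : ℝ)) := by
      push_cast
      field_simp
      ring
    rw [hx]
    have hj := jordan (2 * k + 1) (2 * M) (by omega) (by omega)
    exact ⟨hj.1, hj.2.trans (by rw [mul_add]; exact le_add_of_nonneg_right (mul_nonneg hc hb))⟩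
  · have hy : Real.pi -
        (Real.pi * ((1 : ℕ) : ℝ) + (Real.pi * (k : ℝ) / M + Real.pi / (2 * M))) / 2 =
        ((2 * w + 1 : ℕ) : ℝ) * Real.pi / (2 * ((2 * M : ℕ) : ℝ)) := by
      push_cast
      rw [hwr]
      field_simp
      ring
    rw [← Real.sin_pi_sub, hy]
    have hj := jordan (2 * w + 1) (2 * M) (by omega) (by omega)
    exact ⟨hj.1, hj.2.trans (by rw [mul_add]; exact le_add_of_nonneg_left (mul_nonneg hc ha))⟩

/-! ### The one-dimensional sum -/

/-- Telescoping: `Σ_{i<N} ((√√(2i+1))³)⁻¹ ≤ 4 √√(2N)`, from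
`((√√(2i+1))³)⁻¹ ≤ 4 (√√(2i+1) − √√(2i))` (with `b = √√(2i+1)`, `a = √√(2i)`: `b⁴ − a⁴ = 1` and
`(b + a)(b² + a²) ≤ 4b³`). -/
theorem tele (N : ℕ) :
    ∑ i ∈ Finset.range N, (Real.sqrt (Real.sqrt ((2 * i + 1 : ℕ) : ℝ)) ^ 3)⁻¹ ≤
      4 * Real.sqrt (Real.sqrt ((2 * N : ℕ) : ℝ)) := by
  induction N with
  | zero => simp
  | succ n ih =>
    rw [Finset.sum_range_succ]
    push_cast at ih ⊢
    set a := Real.sqrt (Real.sqrt (2 * (n : ℝ))) with ha_def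
    set b := Real.sqrt (Real.sqrt (2 * (n : ℝ) + 1)) with hb_def
    have ha0 : 0 ≤ a := Real.sqrt_nonneg _
    have hb0 : 0 < b := Real.sqrt_pos.2 (Real.sqrt_pos.2 (by positivity))
    have r4 : ∀ y : ℝ, 0 ≤ y → Real.sqrt (Real.sqrt y) ^ 4 = y := fun y hy => by
      rw [show (4 : ℕ) = 2 * 2 from rfl, pow_mul, Real.sq_sqrt (Real.sqrt_nonneg y), Real.sq_sqrt hy]
    have ha4 : a ^ 4 = 2 * n := r4 _ (by positivity)
    have hb4 : b ^ 4 = 2 * n + 1 := r4 _ (by positivity)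
    have hab : a ≤ b := Real.sqrt_le_sqrt (Real.sqrt_le_sqrt (by linarith))
    have hbc : b ≤ Real.sqrt (Real.sqrt (2 * ((n : ℝ) + 1))) :=
      Real.sqrt_le_sqrt (Real.sqrt_le_sqrt (by linarith))
    have h1 : (b - a) * ((b + a) * (b ^ 2 + a ^ 2)) = 1 := by linear_combination hb4 - ha4
    have h2 : (b + a) * (b ^ 2 + a ^ 2) ≤ 4 * b ^ 3 := by
      nlinarith [pow_le_pow_left₀ ha0 hab 3,
        mul_le_mul_of_nonneg_right (pow_le_pow_left₀ ha0 hab 2) hb0.le,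
        mul_le_mul_of_nonneg_right hab (sq_nonneg b)]
    have key : (b ^ 3)⁻¹ ≤ 4 * (b - a) := by
      rw [← one_div, div_le_iff₀ (pow_pos hb0 3)]
      nlinarith [mul_le_mul_of_nonneg_left h2 (sub_nonneg.2 hab)]
    linarith [ih, key, hbc]

/-- **The one-dimensional bound**: summing `((√√ sin(θ/2))⁻¹)³` over the `2M` antiperiodic angles
`θ = π s' + (π k'/M + π/(2M))`, `k' < M`, `s' ∈ ℤ/2`, gives at most `32 M`. -/
theorem oneDim (M : ℕ) [NeZero M] :
    ∑ k : Fin M, ∑ s : ZMod 2, (Real.sqrt (Real.sqrt (Real.sin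
      ((Real.pi * ((s.val : ℕ) : ℝ) + (Real.pi * ((k : ℕ) : ℝ) / M + Real.pi / (2 * M))) / 2))))⁻¹ ^ 3
      ≤ 32 * M := by
  have hM : 0 < M := Nat.pos_of_ne_zero (NeZero.ne M)
  set l := Real.sqrt (Real.sqrt ((2 * M : ℕ) : ℝ)) with hl
  have hl4 : l ^ 4 = 2 * M := by
    rw [hl, show (4 : ℕ) = 2 * 2 from rfl, pow_mul, Real.sq_sqrt (Real.sqrt_nonneg _),
      Real.sq_sqrt (by positivity)]
    push_cast
    ring
  have hl0 : 0 ≤ l := Real.sqrt_nonneg _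
  set A : ℕ → ℝ := fun i => (Real.sqrt (Real.sqrt ((2 * i + 1 : ℕ) : ℝ)) ^ 3)⁻¹ with hA
  have h1 : ∀ (k : Fin M) (s : ZMod 2), (Real.sqrt (Real.sqrt (Real.sin
      ((Real.pi * ((s.val : ℕ) : ℝ) + (Real.pi * ((k : ℕ) : ℝ) / M + Real.pi / (2 * M))) / 2))))⁻¹ ^ 3
      ≤ l ^ 3 * (A k + A (M - 1 - k)) := fun k s =>
    (coord M k s.val k.isLt (ZMod.val_lt s)).2
  have h2 : ∀ k : Fin M, ∑ _s : ZMod 2, l ^ 3 * (A k + A (M - 1 - k)) =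
      2 * (l ^ 3 * (A k + A (M - 1 - k))) := fun k => by
    rw [Finset.sum_const, Finset.card_univ, ZMod.card, nsmul_eq_mul, Nat.cast_ofNat]
  calc _ ≤ ∑ k : Fin M, ∑ _s : ZMod 2, l ^ 3 * (A k + A (M - 1 - k)) :=
        sum_le_sum fun k _ => sum_le_sum fun s _ => h1 k s
    _ = ∑ k : Fin M, 2 * (l ^ 3 * (A k + A (M - 1 - k))) := sum_congr rfl fun k _ => h2 k
    _ = 2 * l ^ 3 * ∑ i ∈ range M, (A i + A (M - 1 - i)) := by
        rw [← Fin.sum_univ_eq_sum_range (fun i => A i + A (M - 1 - i)) M, mul_sum]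
        exact sum_congr rfl fun k _ => by ring
    _ = 2 * l ^ 3 * (2 * ∑ i ∈ range M, A i) := by
        rw [sum_add_distrib, sum_range_reflect A M]
        ring
    _ ≤ 2 * l ^ 3 * (2 * (4 * l)) := by gcongr; exact tele M
    _ = 16 * l ^ 4 := by ring
    _ = 32 * M := by rw [hl4]; ring

/-! ### Assembly -/

/-- **Separable assembly**: if `F k s ≤ Π_μ g (k μ) (s μ)` with `g ≥ 0` and `Σ_a Σ_b g a b ≤ T`,
then `Σ_k Σ_s F k s ≤ T⁴`, by `Σ_k Σ_s Π_μ g (k μ) (s μ) = (Σ_a Σ_b g a b)⁴`. -/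
theorem assemble {A B : Type*} [Fintype A] [Fintype B] (F : (Fin 4 → A) → (Fin 4 → B) → ℝ)
    (g : A → B → ℝ) (hF : ∀ k s, F k s ≤ ∏ μ, g (k μ) (s μ)) (hg0 : ∀ a b, 0 ≤ g a b) {T : ℝ}
    (hg : ∑ a, ∑ b, g a b ≤ T) : ∑ k, ∑ s, F k s ≤ T ^ 4 := by
  have hs0 : 0 ≤ ∑ a, ∑ b, g a b := sum_nonneg fun a _ => sum_nonneg fun b _ => hg0 a b
  calc ∑ k, ∑ s, F k s ≤ ∑ k : Fin 4 → A, ∑ s : Fin 4 → B, ∏ μ, g (k μ) (s μ) :=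
        sum_le_sum fun k _ => sum_le_sum fun s _ => hF k s
    _ = ∑ k : Fin 4 → A, ∏ μ, ∑ b, g (k μ) b :=
        sum_congr rfl fun k _ => (Fintype.prod_sum fun μ b => g (k μ) b).symm
    _ = (∑ a, ∑ b, g a b) ^ 4 := (Fintype.sum_pow (fun a => ∑ b, g a b) 4).symm
    _ ≤ T ^ 4 := pow_le_pow_left₀ hs0 hg 4

end BlochLatticeSum

/-- **Stub 3e (`stub_blochLatticeSum`): the antiperiodic `d = 4` lattice sum with exponent `3/2`.**
For `|m| ≤ 1/2` and every `M ≥ 1`, `Σ_{k ∈ (Fin M)⁴} Σ_{s ∈ (ℤ/2)⁴} √h/h² ≤ 32⁴ · M⁴`, where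
`h = (m + Σ_μ (1 − cos φ_μ))² + Σ_μ sin² φ_μ` at the antiperiodic angles `φ_μ = π s_μ + π k_μ/M + π/(2M)`.
Proof: `h ≥ Σ_μ (1 − cos φ_μ) ≥ sin²(φ_μ/2)` for each `μ` (`m ≥ −1/2`), so `√h/h² ≤ Π_μ sin(φ_μ/2)^{-3/4}`;
the sum separates into the fourth power of a one-dimensional sum, which Jordan's inequality and a
telescoping bound by `32 M`.  Constants: `C = 32⁴`, `ε = 1/2`. -/
theorem stub_blochLatticeSum : ∃ C ε : ℝ, 0 < ε ∧ ∀ (M : ℕ) [NeZero M] (m : ℝ), |m| ≤ ε → ∑ k : Fin 4 → Fin M, ∑ s : Fin 4 → ZMod 2, Real.sqrt ((m + ∑ μ : Fin 4, (1 - Real.cos (Real.pi * ((s μ).val : ℝ) + (Real.pi * ((k μ : ℕ) : ℝ) / M + Real.pi / (2 * M))))) ^ 2 + ∑ μ : Fin 4, Real.sin (Real.pi * ((s μ).val : ℝ) + (Real.pi * ((k μ : ℕ) : ℝ) / M + Real.pi / (2 * M))) ^ 2) / ((m + ∑ μ : Fin 4, (1 - Real.cos (Real.pi * ((s μ).val :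 ℝ) + (Real.pi * ((k μ : ℕ) : ℝ) / M + Real.pi / (2 * M))))) ^ 2 + ∑ μ : Fin 4, Real.sin (Real.pi * ((s μ).val : ℝ) + (Real.pi * ((k μ : ℕ) : ℝ) / M + Real.pi / (2 * M))) ^ 2) ^ 2 ≤ C * (M : ℝ) ^ 4 := by
  refine ⟨32 ^ 4, 1 / 2, one_half_pos, fun M _ m hm => ?_⟩
  have hm' : -(1 / 2) ≤ m := (abs_le.1 hm).1
  have key := BlochLatticeSum.assemble _
    (fun (k' : Fin M) (s' : ZMod 2) => (Real.sqrt (Real.sqrt (Real.sin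
      ((Real.pi * ((s'.val : ℕ) : ℝ) + (Real.pi * ((k' : ℕ) : ℝ) / M + Real.pi / (2 * M))) / 2))))⁻¹ ^ 3)
    (fun k s => BlochLatticeSum.pointwise m hm' _ fun μ =>
      (BlochLatticeSum.coord M (k μ) (s μ).val (k μ).isLt (ZMod.val_lt (s μ))).1)
    (fun _ _ => by positivity) (BlochLatticeSum.oneDim M)
  calc _ ≤ ((32 : ℝ) * M) ^ 4 := key
    _ = 32 ^ 4 * (M : ℝ) ^ 4 := mul_pow _ _ _

end Summit.QuantumFields.QCD.Cruxes.CriticalLineDiamagnetism.ChessboardCellGain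

end
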